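import Mathlib.InformationTheory.KullbackLeibler.Basic
import Mathlib.MeasureTheory.Integral.Bochner.Set
import Literature.Probability.Process.FibreCondExp
import HarnessLib

/-!
# Countable measurable partitions: fibre sums and the partition data-processing inequality

Helper for the line `equilibrium-forecast-chain-rule` of the crux
`InformationPercolationEngine.PercolationClosesChaos` (stmt-AtomisticToContinuum-15178), stub
`stub_predictableProjection` (the predictable-projection bound). Measure-theoretic bookkeeping for the
fibres `Z ⁻¹' {s}` of a map `Z : Ω → S` into a countable set (a countable measurable partition of `Ω`):

* `hasSum_setIntegral_inter_fibre`, `hasSum_measureReal_inter_fibre` — a set integral (a real mass) over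
  `A` is the sum over `s` of the set integrals (masses) over `A ∩ Z ⁻¹' {s}`;
* `exists_eq_comp_of_measurable_comap_top`, `setIntegral_fibre_eq_mul` — a `σ(Z)`-measurable real map is a
  function of `Z`, and its integral over a fibre is value × mass;
* `setIntegral_abs_condExp_sub_condExp_fibre` — on a fibre of positive `μ`- and `ν`-mass the two elementary
  conditional expectations `μ[X | σ(π)]`, `ν[X | σ(π)]` are the two fibre averages, so the fibre integral of
  their absolute difference is mass × |difference of averages| (`condExp_comap_top_apply_of_ne_zero`);
* `rnDeriv_restrict_ae_eq` — `d(μ|_A)/d(ν|_A) = dμ/dν` a.e. on `A` (`μ ≪ ν`);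
* `mul_klFun_measureReal_le_setIntegral` — **data processing on one atom**:
  `ν(A) klFun(μ(A)/ν(A)) ≤ ∫_A klFun(dμ/dν) dν` (Jensen, `MeasureTheory.mul_le_integral_rnDeriv_of_ac` for
  the restrictions);
* `summable_mul_klFun_fibre`, `tsum_mul_klFun_fibre_le_toReal_klDiv` — **partition data processing**:
  `Σ'_t ν(A_t) klFun(μ(A_t)/ν(A_t)) ≤ KL(μ ‖ ν)` for the fibres `A_t` of a map into a countable set, when
  `μ ≪ ν` and `llr μ ν` is `μ`-integrable (i.e. `KL(μ ‖ ν) < ∞`).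

## References
* Y. Polyanskiy, Y. Wu, *Information Theory: From Coding to Learning* (2024), Thm. 2.17 / §7.2
  (data-processing inequality for divergences under a deterministic quantiser).
* D. Williams, *Probability with Martingales* (1991), §9.1 (elementary conditional expectation).
-/

noncomputable section

namespace Summit.AtomisticToContinuum.HydrodynamicLimit.Theorems.EquilibriumForecastLine

open MeasureTheory Set InformationTheory Literature.Probability.Process
open scoped ENNReal

variable {Ω : Type*} {mΩ : MeasurableSpace Ω}

/-! ### Fibre sums -/

/-- Fibres of a map are pairwise disjoint (also after intersecting with a fixed set). [folklore] -/
theorem pairwise_disjoint_inter_fibre {S : Type*} (Z : Ω → S) (A : Set Ω) :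
    Pairwise (Function.onFun Disjoint fun s => A ∩ Z ⁻¹' {s}) := fun _ _ hst =>
  Set.disjoint_left.2 fun _ hx hx' => hst ((mem_singleton_iff.1 hx.2).symm.trans (mem_singleton_iff.1 hx'.2))

/-- The pieces `A ∩ Z ⁻¹' {s}` cover `A`. [folklore] -/
theorem iUnion_inter_fibre {S : Type*} (Z : Ω → S) (A : Set Ω) : (⋃ s, A ∩ Z ⁻¹' {s}) = A := by
  ext x
  simp

/-- **Set integrals split along the fibres of a map into a countable set**: for an integrable `f`,
`∫_A f dμ = Σ'_s ∫_{A ∩ {Z = s}} f dμ` (as a `HasSum`). [folklore] -/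
theorem hasSum_setIntegral_inter_fibre {S : Type*} [Countable S] (μ : Measure Ω) (Z : Ω → S)
    (hZ : ∀ s, MeasurableSet (Z ⁻¹' {s})) {A : Set Ω} (hA : MeasurableSet A) {f : Ω → ℝ}
    (hf : Integrable f μ) :
    HasSum (fun s => ∫ x in A ∩ Z ⁻¹' {s}, f x ∂μ) (∫ x in A, f x ∂μ) := by
  have h := hasSum_integral_iUnion (μ := μ) (f := f) (fun s => hA.inter (hZ s))
    (pairwise_disjoint_inter_fibre Z A) hf.integrableOn
  rwa [iUnion_inter_fibre Z A] at h

/-- **Masses split along the fibres of a map into a countable set**: `μ(A) = Σ'_s μ(A ∩ {Z = s})` for a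
finite measure, in `Measure.real` form (as a `HasSum`). [folklore] -/
theorem hasSum_measureReal_inter_fibre {S : Type*} [Countable S] (μ : Measure Ω) [IsFiniteMeasure μ]
    (Z : Ω → S) (hZ : ∀ s, MeasurableSet (Z ⁻¹' {s})) {A : Set Ω} (hA : MeasurableSet A) :
    HasSum (fun s => μ.real (A ∩ Z ⁻¹' {s})) (μ.real A) := by
  have h := hasSum_setIntegral_inter_fibre μ Z hZ hA (integrable_const (1 : ℝ))
  simpa using h

/-! ### Functions measurable for `σ(Z)` -/

/-- A real map measurable for `σ(Z) = comap Z ⊤` is a function of `Z`. [folklore] -/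
theorem exists_eq_comp_of_measurable_comap_top {R : Type*} {ρ : Ω → R} {X : Ω → ℝ}
    (hX : Measurable[MeasurableSpace.comap ρ ⊤] X) : ∃ g : R → ℝ, ∀ ω, X ω = g (ρ ω) := by
  classical
  refine ⟨fun r => if h : ∃ ω, ρ ω = r then X h.choose else 0, fun ω => ?_⟩
  have h : ∃ ω', ρ ω' = ρ ω := ⟨ω, rfl⟩
  show X ω = (if h : ∃ ω', ρ ω' = ρ ω then X h.choose else 0)
  rw [dif_pos h]
  exact apply_eq_of_measurable_comap_top hX h.choose_spec.symm

/-- The integral of `g ∘ ρ` over a fibre `{ρ = r}` is `μ(ρ = r) · g r`. [folklore] -/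
theorem setIntegral_fibre_eq_mul {R : Type*} (μ : Measure Ω) {ρ : Ω → R} {X : Ω → ℝ} {g : R → ℝ}
    (hXg : ∀ ω, X ω = g (ρ ω)) (hρ : ∀ r, MeasurableSet (ρ ⁻¹' {r})) (r : R) :
    ∫ x in ρ ⁻¹' {r}, X x ∂μ = μ.real (ρ ⁻¹' {r}) * g r := by
  have hconst : ∀ x ∈ ρ ⁻¹' {r}, X x = g r := fun x hx => by
    rw [hXg x, mem_singleton_iff.1 (mem_preimage.1 hx)]
  rw [setIntegral_congr_fun (hρ r) hconst, setIntegral_const, smul_eq_mul]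

/-! ### Elementary conditional expectations on a fibre -/

/-- **On a fibre of positive `μ`- and `ν`-mass, `∫ |μ[X|σ(π)] - ν[X|σ(π)]| dμ` is mass × |difference of
the two fibre averages|** (both conditional expectations are constant on the fibre and equal to the fibre
averages there, `condExp_comap_top_apply_of_ne_zero`). [folklore] -/
theorem setIntegral_abs_condExp_sub_condExp_fibre {T : Type*} (μ ν : Measure Ω) [IsFiniteMeasure μ]
    [IsFiniteMeasure ν] {π : Ω → T} (hle : MeasurableSpace.comap π ⊤ ≤ mΩ) {X : Ω → ℝ}
    (hXμ : Integrable X μ) (hXν : Integrable X ν) {t : T} (hμt : μ (π ⁻¹' {t}) ≠ 0)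
    (hνt : ν (π ⁻¹' {t}) ≠ 0) :
    ∫ x in π ⁻¹' {t}, |μ[X | MeasurableSpace.comap π ⊤] x - ν[X | MeasurableSpace.comap π ⊤] x| ∂μ =
      μ.real (π ⁻¹' {t}) * |(μ.real (π ⁻¹' {t}))⁻¹ * ∫ x in π ⁻¹' {t}, X x ∂μ -
        (ν.real (π ⁻¹' {t}))⁻¹ * ∫ x in π ⁻¹' {t}, X x ∂ν| := by
  have hconst : ∀ x ∈ π ⁻¹' {t},
      |μ[X | MeasurableSpace.comap π ⊤] x - ν[X | MeasurableSpace.comap π ⊤] x| =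
        |(μ.real (π ⁻¹' {t}))⁻¹ * ∫ x in π ⁻¹' {t}, X x ∂μ -
          (ν.real (π ⁻¹' {t}))⁻¹ * ∫ x in π ⁻¹' {t}, X x ∂ν| := by
    intro x hx
    have hx' : π x = t := mem_singleton_iff.1 (mem_preimage.1 hx)
    have h1 := condExp_comap_top_apply_of_ne_zero (μ := μ) hle hXμ (ω := x) (by rwa [hx'])
    have h2 := condExp_comap_top_apply_of_ne_zero (μ := ν) hle hXν (ω := x) (by rwa [hx'])
    rw [hx'] at h1 h2
    rw [h1, h2]
  rw [setIntegral_congr_fun (hle _ (measurableSet_comap_top_fibre π t)) hconst, setIntegral_const,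
    smul_eq_mul]

/-! ### Data processing over a countable measurable partition -/

/-- `d(μ|_A)/d(ν|_A) = dμ/dν` almost everywhere on `A`, for `μ ≪ ν`. [folklore] -/
theorem rnDeriv_restrict_ae_eq (μ ν : Measure Ω) [SigmaFinite μ] [SigmaFinite ν] (hμν : μ ≪ ν)
    {A : Set Ω} (hA : MeasurableSet A) :
    (μ.restrict A).rnDeriv (ν.restrict A) =ᵐ[ν.restrict A] μ.rnDeriv ν := by
  have h : μ.restrict A = (ν.restrict A).withDensity (μ.rnDeriv ν) := by
    conv_lhs => rw [← Measure.withDensity_rnDeriv_eq μ ν hμν]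
    exact restrict_withDensity hA _
  rw [h]
  exact Measure.rnDeriv_withDensity _ (Measure.measurable_rnDeriv μ ν)

/-- **Data processing on one atom** (Jensen for the convex `klFun` under `ν(· | A)`):
`ν(A) · klFun(μ(A)/ν(A)) ≤ ∫_A klFun(dμ/dν) dν` for finite measures `μ ≪ ν` with `llr μ ν ∈ L¹(μ)` and a
measurable `A`. [folklore] -/
theorem mul_klFun_measureReal_le_setIntegral (μ ν : Measure Ω) [IsFiniteMeasure μ] [IsFiniteMeasure ν]
    (hμν : μ ≪ ν) (h_int : Integrable (llr μ ν) μ) {A : Set Ω} (hA : MeasurableSet A) :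
    ν.real A * klFun (μ.real A / ν.real A) ≤ ∫ x in A, klFun (μ.rnDeriv ν x).toReal ∂ν := by
  have hae := rnDeriv_restrict_ae_eq μ ν hμν hA
  have hint : Integrable (fun x => klFun (μ.rnDeriv ν x).toReal) ν :=
    (integrable_klFun_rnDeriv_iff hμν).mpr h_int
  have hint' : Integrable (fun x => klFun ((μ.restrict A).rnDeriv (ν.restrict A) x).toReal)
      (ν.restrict A) := by
    refine (integrable_congr ?_).mpr hint.restrict
    filter_upwards [hae] with x hx
    rw [hx]
  have h := mul_le_integral_rnDeriv_of_ac (μ := μ.restrict A) (ν := ν.restrict A) convexOn_klFun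
    continuous_klFun.continuousWithinAt hint' (hμν.restrict A)
  have heq : ∫ x, klFun ((μ.restrict A).rnDeriv (ν.restrict A) x).toReal ∂(ν.restrict A) =
      ∫ x in A, klFun (μ.rnDeriv ν x).toReal ∂ν := by
    refine integral_congr_ae ?_
    filter_upwards [hae] with x hx
    rw [hx]
  rwa [heq, measureReal_restrict_apply_univ, measureReal_restrict_apply_univ] at h

/-- **Partition data processing, summability**: for finite measures `μ ≪ ν` with `llr μ ν ∈ L¹(μ)` and a map
`π` into a countable set with measurable fibres `A_t = {π = t}`, the family `ν(A_t) klFun(μ(A_t)/ν(A_t))`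
is summable. [folklore] -/
theorem summable_mul_klFun_fibre {T : Type*} [Countable T] (μ ν : Measure Ω) [IsFiniteMeasure μ]
    [IsFiniteMeasure ν] (hμν : μ ≪ ν) (h_int : Integrable (llr μ ν) μ) (π : Ω → T)
    (hπ : ∀ t, MeasurableSet (π ⁻¹' {t})) :
    Summable fun t => ν.real (π ⁻¹' {t}) * klFun (μ.real (π ⁻¹' {t}) / ν.real (π ⁻¹' {t})) := by
  have hint : Integrable (fun x => klFun (μ.rnDeriv ν x).toReal) ν :=
    (integrable_klFun_rnDeriv_iff hμν).mpr h_int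
  have hF := hasSum_setIntegral_inter_fibre ν π hπ MeasurableSet.univ hint
  simp only [univ_inter] at hF
  refine Summable.of_nonneg_of_le (fun t => ?_) (fun t => ?_) hF.summable
  · exact mul_nonneg measureReal_nonneg (klFun_nonneg (div_nonneg measureReal_nonneg measureReal_nonneg))
  · exact mul_klFun_measureReal_le_setIntegral μ ν hμν h_int (hπ t)

/-- **Partition data processing** (deterministic quantiser): for finite measures `μ ≪ ν` with
`llr μ ν ∈ L¹(μ)` and a map `π` into a countable set with measurable fibres `A_t = {π = t}`,
`Σ'_t ν(A_t) klFun(μ(A_t)/ν(A_t)) ≤ KL(μ ‖ ν)` (for probability measures the left side is the relative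
entropy of the two laws of `π`). [folklore] -/
theorem tsum_mul_klFun_fibre_le_toReal_klDiv {Ω : Type*} {mΩ : MeasurableSpace Ω} {T : Type*} [Countable T]
    (μ ν : Measure Ω) [IsFiniteMeasure μ] [IsFiniteMeasure ν] (hμν : μ ≪ ν) (h_int : Integrable (llr μ ν) μ)
    (π : Ω → T) (hπ : ∀ t, MeasurableSet (π ⁻¹' {t})) :
    ∑' t, ν.real (π ⁻¹' {t}) * klFun (μ.real (π ⁻¹' {t}) / ν.real (π ⁻¹' {t})) ≤ (klDiv μ ν).toReal := by
  have hint : Integrable (fun x => klFun (μ.rnDeriv ν x).toReal) ν :=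
    (integrable_klFun_rnDeriv_iff hμν).mpr h_int
  have hF := hasSum_setIntegral_inter_fibre ν π hπ MeasurableSet.univ hint
  simp only [univ_inter, Measure.restrict_univ] at hF
  rw [toReal_klDiv_eq_integral_klFun hμν, ← hF.tsum_eq]
  exact (summable_mul_klFun_fibre μ ν hμν h_int π hπ).tsum_le_tsum
    (fun t => mul_klFun_measureReal_le_setIntegral μ ν hμν h_int (hπ t)) hF.summable

end Summit.AtomisticToContinuum.HydrodynamicLimit.Theorems.EquilibriumForecastLine

end
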